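import Literature.NumberTheory.QuadraticForms.TransferFormRealQuadratic
import Mathlib.NumberTheory.NumberField.InfinitePlace.TotallyRealComplex
import Mathlib.LinearAlgebra.FiniteDimensional.Lemmas
import HarnessLib

/-!
# Real quadratic fields: a generator `θ = √d`, real embeddings, and signs of transfer blocks

Topic `Literature/NumberTheory/QuadraticForms`; namespace `Literature.NumberTheory.QuadraticForms`.
Everything here is proved; this is the sign bookkeeping for the discharge of Cor. 11.4 of
Bayer-Fluckiger–van Geemen–Schütt 2025 (`BFvGS2025_transfer_realQuadratic_of_det_neg_one`,
`TransferForm.lean`; assembled in `TransferFormProofs.lean`):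

* `exists_sqrt_generator` — a totally real number field `E` of degree `2` is `ℚ ⊕ ℚθ` with
  `θ² = d`, `d > 0` a rational non-square, and has a real embedding `σ` with `σ(θ) > 0`
  (complete the square of the minimal polynomial of any irrational element; `σ(θ)² = d`);
* `embedding_coord` — `σ(u + vθ) = u + v σ(θ)`;
* `exists_mixed_pair` — **the `E`-side step of the proof**: if `β₁ ≫ 0` (totally positive)
  and `β₂ ≪ 0` then the binary `E`-form `⟨β₁, β₂⟩` is also `≅ ⟨γ, β₁β₂/γ⟩` with `γ = β₁ X² + β₂`
  of mixed sign at the two real places (take `σ(X)` large and `σ̄(X)` small: weak approximation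
  in `E ⊗ ℝ = ℝ × ℝ`, here just the density of `ℚ` in `ℝ`), hence
  `T⟨β₁⟩ ⊥ T⟨β₂⟩ ≅ T⟨γ⟩ ⊥ T⟨γ'⟩` with `γ, γ'` of mixed signs (transfers of `E`-isometric forms
  are isometric). In the source this freedom is built into the choice of `W'` in the proof of
  Thm. 11.2 ("`σ(αᵢ) > 0` if and only if `i ≤ r₀`").
* small regrouping isometries for families indexed by `Fin 2`, `Fin 3`.

## References

* [BayerFluckigerVanGeemenSchuett2025] E. Bayer-Fluckiger, B. van Geemen, M. Schütt,
  *Non-projective K3 surfaces with real or Salem multiplication*, arXiv:2511.19970, §10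
  (real embeddings `Σ_E`, signatures of `W_σ`), Thm. 11.2.
-/

namespace Literature.NumberTheory.QuadraticForms

open QuadraticMap Module

/-! ### Regrouping for `Fin 2` and `Fin 3` -/

section Regroup

variable {R : Type*} [CommSemiring R] {M N : Type*} [AddCommMonoid M] [AddCommMonoid N]
  [Module R M] [Module R N]

/-- `⊥_{i < 2} Qᵢ ≅ Q₀ ⊥ Q₁`. [folklore] -/
theorem equivalent_pi_fin_two (Q : Fin 2 → QuadraticMap R M N) :
    Equivalent (QuadraticMap.pi Q) ((Q 0).prod (Q 1)) :=
  ⟨{ LinearEquiv.finTwoArrow R M with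
      map_app' := fun v => by simp [Fin.sum_univ_two, LinearEquiv.finTwoArrow] }⟩

/-- `Q₀ ⊥ (Q₁ ⊥ Q₂) ≅ ⊥_{i < 3} Qᵢ`. [folklore] -/
theorem equivalent_prod_prod_pi_fin_three (Q : Fin 3 → QuadraticMap R M N) :
    Equivalent ((Q 0).prod ((Q 1).prod (Q 2))) (QuadraticMap.pi Q) :=
  ⟨{ toFun := fun p => ![p.1, p.2.1, p.2.2]
     invFun := fun v => (v 0, v 1, v 2)
     map_add' := fun p p' => by
       ext i; fin_cases i <;> rfl
     map_smul' := fun a p => by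
       ext i; fin_cases i <;> rfl
     left_inv := fun p => rfl
     right_inv := fun v => by
       ext i; fin_cases i <;> rfl
     map_app' := fun p => by
       simp [Fin.sum_univ_three, add_assoc] }⟩

end Regroup

/-! ### A generator `θ = √d` and a real embedding -/

section Generator

variable {E : Type*} [Field E] [NumberField E] [NumberField.IsTotallyReal E]

/-- **A real quadratic field is `ℚ(√d)`.** If `E` is a totally real number field with
`[E : ℚ] = 2` then there are `θ ∈ E`, a rational `d > 0` which is not a square, a `ℚ`-basis
`(1, θ)` of `E` with `θ² = d`, and a real embedding `σ : E → ℝ` with `σ(θ) > 0` (complete the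
square: for `θ₀ ∉ ℚ`, `θ₀² = p + qθ₀` and `θ = 2θ₀ - q` has `θ² = 4p + q²`; `d = σ(θ)² > 0`).
[folklore] -/
theorem exists_sqrt_generator (hE : finrank ℚ E = 2) :
    ∃ (θ : E) (d : ℚ) (b : Basis (Fin 2) ℚ E) (σ : E →+* ℝ),
      θ * θ = algebraMap ℚ E d ∧ b 0 = 1 ∧ b 1 = θ ∧ 0 < d ∧ ¬ IsSquare d ∧ 0 < σ θ := by
  classical
  -- a real embedding
  obtain ⟨w⟩ := (inferInstance : Nonempty (NumberField.InfinitePlace E))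
  let σ : E →+* ℝ := NumberField.InfinitePlace.embedding_of_isReal
    (NumberField.IsTotallyReal.isReal w)
  have hσq : ∀ q : ℚ, σ (algebraMap ℚ E q) = q := fun q => eq_ratCast (σ.comp (algebraMap ℚ E)) q
  -- an irrational element
  have hirr : ∃ θ₀ : E, ∀ c : ℚ, algebraMap ℚ E c ≠ θ₀ := by
    by_contra hall
    push Not at hall
    have h1 : finrank ℚ E = 1 := (finrank_eq_one_iff_of_nonzero' (1 : E) one_ne_zero).mpr
      fun x => by
        obtain ⟨c, hc⟩ := hall x
        exact ⟨c, by rw [← hc, Algebra.algebraMap_eq_smul_one]⟩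
    omega
  obtain ⟨θ₀, hθ₀⟩ := hirr
  -- `(1, θ₀)` is a basis; `θ₀² = p + q θ₀`
  have hli₀ : LinearIndependent ℚ ![(1 : E), θ₀] := by
    refine LinearIndependent.pair_iff.mpr fun s t hst => ?_
    by_cases ht : t = 0
    · subst ht
      simp only [zero_smul, add_zero, smul_eq_zero, one_ne_zero, or_false] at hst
      exact ⟨hst, rfl⟩
    · exfalso
      refine hθ₀ (-s / t) ?_
      have : t • θ₀ = -(s • (1 : E)) := eq_neg_of_add_eq_zero_right hst
      rw [Algebra.algebraMap_eq_smul_one, div_eq_mul_inv, mul_comm, mul_smul, neg_smul, ← this,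
        smul_smul, inv_mul_cancel₀ ht, one_smul]
  let b₀ : Basis (Fin 2) ℚ E := basisOfLinearIndependentOfCardEqFinrank hli₀ (by rw [hE]; rfl)
  have hb₀0 : b₀ 0 = 1 := by
    change (basisOfLinearIndependentOfCardEqFinrank hli₀ _) 0 = 1
    rw [coe_basisOfLinearIndependentOfCardEqFinrank]; rfl
  have hb₀1 : b₀ 1 = θ₀ := by
    change (basisOfLinearIndependentOfCardEqFinrank hli₀ _) 1 = θ₀
    rw [coe_basisOfLinearIndependentOfCardEqFinrank]; rfl
  set p : ℚ := b₀.repr (θ₀ * θ₀) 0 with hp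
  set q : ℚ := b₀.repr (θ₀ * θ₀) 1 with hq
  have hsq : θ₀ * θ₀ = algebraMap ℚ E p + algebraMap ℚ E q * θ₀ :=
    eq_coord_add_coord_mul b₀ hb₀0 hb₀1 (θ₀ * θ₀)
  -- complete the square
  set θ₁ : E := 2 * θ₀ - algebraMap ℚ E q with hθ₁
  set d : ℚ := 4 * p + q ^ 2 with hd
  have hθ₁sq : θ₁ * θ₁ = algebraMap ℚ E d := by
    rw [hθ₁, hd, map_add, map_mul, map_pow]
    have h4 : algebraMap ℚ E 4 = 4 := by norm_num [map_ofNat]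
    rw [h4]
    linear_combination (4 : E) * hsq
  have hθ₁irr : ∀ c : ℚ, algebraMap ℚ E c ≠ θ₁ := fun c hc => by
    refine hθ₀ ((c + q) / 2) ?_
    rw [map_div₀, map_add, hc, hθ₁]
    have h2 : algebraMap ℚ E 2 = 2 := by norm_num [map_ofNat]
    rw [h2]
    ring
  have hd0 : d ≠ 0 := fun h0 => by
    refine hθ₁irr 0 ?_
    rw [map_zero]
    have : θ₁ * θ₁ = 0 := by rw [hθ₁sq, h0, map_zero]
    exact (mul_self_eq_zero.mp this).symm
  have hd1 : ¬ IsSquare d := by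
    rintro ⟨r, hr⟩
    have hfac : (θ₁ - algebraMap ℚ E r) * (θ₁ + algebraMap ℚ E r) = 0 := by
      have : θ₁ * θ₁ = algebraMap ℚ E r * algebraMap ℚ E r := by rw [hθ₁sq, hr, map_mul]
      linear_combination this
    rcases mul_eq_zero.mp hfac with h | h
    · exact hθ₁irr r (sub_eq_zero.mp h).symm
    · exact hθ₁irr (-r) (by rw [map_neg]; exact neg_eq_of_add_eq_zero_left h)
  have hdpos : 0 < d := by
    have h1 : (σ θ₁) ^ 2 = d := by rw [pow_two, ← map_mul, hθ₁sq, hσq]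
    have h3 : (0 : ℝ) < d := by
      rw [← h1]
      refine lt_of_le_of_ne (sq_nonneg _) (Ne.symm (pow_ne_zero 2 fun h0 => hd0 ?_))
      have : ((d : ℚ) : ℝ) = 0 := by rw [← h1, h0]; norm_num
      exact_mod_cast this
    exact_mod_cast h3
  -- fix the sign of `σ θ`
  obtain ⟨θ, hθsq, hθirr, hθpos⟩ : ∃ θ : E, θ * θ = algebraMap ℚ E d ∧
      (∀ c : ℚ, algebraMap ℚ E c ≠ θ) ∧ 0 < σ θ := by
    have hne : σ θ₁ ≠ 0 := fun h0 => by
      have h1 : (σ θ₁) ^ 2 = d := by rw [pow_two, ← map_mul, hθ₁sq, hσq]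
      rw [h0] at h1
      have : ((d : ℚ) : ℝ) = 0 := by rw [← h1]; norm_num
      exact hd0 (by exact_mod_cast this)
    rcases lt_or_gt_of_ne hne with hlt | hgt
    · refine ⟨-θ₁, by rw [neg_mul_neg, hθ₁sq], fun c hc => hθ₁irr (-c) ?_, ?_⟩
      · rw [map_neg, hc, neg_neg]
      · rw [map_neg]; exact neg_pos.mpr hlt
    · exact ⟨θ₁, hθ₁sq, hθ₁irr, hgt⟩
  -- the basis `(1, θ)`
  have hli : LinearIndependent ℚ ![(1 : E), θ] := by
    refine LinearIndependent.pair_iff.mpr fun s t hst => ?_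
    by_cases ht : t = 0
    · subst ht
      simp only [zero_smul, add_zero, smul_eq_zero, one_ne_zero, or_false] at hst
      exact ⟨hst, rfl⟩
    · exfalso
      refine hθirr (-s / t) ?_
      have : t • θ = -(s • (1 : E)) := eq_neg_of_add_eq_zero_right hst
      rw [Algebra.algebraMap_eq_smul_one, div_eq_mul_inv, mul_comm, mul_smul, neg_smul, ← this,
        smul_smul, inv_mul_cancel₀ ht, one_smul]
  let b : Basis (Fin 2) ℚ E := basisOfLinearIndependentOfCardEqFinrank hli (by rw [hE]; rfl)
  refine ⟨θ, d, b, σ, hθsq, ?_, ?_, hdpos, hd1, hθpos⟩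
  · change (basisOfLinearIndependentOfCardEqFinrank hli _) 0 = 1
    rw [coe_basisOfLinearIndependentOfCardEqFinrank]; rfl
  · change (basisOfLinearIndependentOfCardEqFinrank hli _) 1 = θ
    rw [coe_basisOfLinearIndependentOfCardEqFinrank]; rfl

end Generator

/-! ### Signs of transfer blocks at the real places -/

section Signs

variable {E : Type*} [Field E] [Algebra ℚ E] {θ : E} {d : ℚ}
  (hθ : θ * θ = algebraMap ℚ E d) (b : Basis (Fin 2) ℚ E) (hb0 : b 0 = 1) (hb1 : b 1 = θ)
  (σ : E →+* ℝ)

/-- `σ(u + vθ) = u + v σ(θ)` for a ring homomorphism `σ : E → ℝ`. [folklore] -/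
theorem embedding_coord (u v : ℚ) :
    σ (algebraMap ℚ E u + algebraMap ℚ E v * θ) = u + v * σ θ := by
  have h : ∀ q : ℚ, σ (algebraMap ℚ E q) = q := fun q => eq_ratCast (σ.comp (algebraMap ℚ E)) q
  rw [map_add, map_mul, h, h]

/-- Density of `ℚ` in `ℝ × ℝ` along `x ↦ (x + Ns, x - Ns)`: for `A, A' > 0 > B, B'` and `s > 0`
there are `x ∈ ℚ`, `N ∈ ℕ` with `A (x + N s)² + B > 0` and `A' (x - N s)² + B' < 0`. [folklore] -/
theorem exists_rat_nat_mixed {A A' B B' s : ℝ} (hA : 0 < A) (hA' : 0 < A') (hB : B < 0)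
    (hB' : B' < 0) (hs : 0 < s) :
    ∃ (x : ℚ) (N : ℕ), 0 < A * (x + N * s) ^ 2 + B ∧ A' * (x - N * s) ^ 2 + B' < 0 := by
  -- `δ ≤ 1` with `A' δ < -B'`
  obtain ⟨δ, hδ0, hδ1, hδA⟩ : ∃ δ : ℝ, 0 < δ ∧ δ ≤ 1 ∧ A' * δ < -B' := by
    refine ⟨min 1 (-B' / (2 * A')), lt_min one_pos (div_pos (neg_pos.mpr hB') (by positivity)),
      min_le_left _ _, ?_⟩
    calc A' * min 1 (-B' / (2 * A')) ≤ A' * (-B' / (2 * A')) :=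
          mul_le_mul_of_nonneg_left (min_le_right _ _) hA'.le
      _ = -B' / 2 := by field_simp
      _ < -B' := by linarith
  -- `N` with `2 N s - 1 ≥ C := 1 - B / A`
  set C : ℝ := 1 - B / A with hC
  have hC1 : 1 < C := by
    have : 0 < -B / A := div_pos (neg_pos.mpr hB) hA
    rw [hC]; linarith [neg_div A B]
  obtain ⟨N, hN⟩ := exists_nat_ge ((C + 1) / (2 * s))
  have hN' : C + 1 ≤ 2 * N * s := by
    have := (div_le_iff₀ (by positivity : (0 : ℝ) < 2 * s)).mp hN
    linarith
  -- `x` within `δ` of `N s`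
  obtain ⟨x, hx1, hx2⟩ := exists_rat_btwn (show (N : ℝ) * s - δ < N * s + δ by linarith)
  refine ⟨x, N, ?_, ?_⟩
  · have hy : C < x + N * s := by linarith
    have hy2 : C ^ 2 < (x + N * s) ^ 2 := by nlinarith
    have hAC : A * C = A - B := by
      rw [hC, mul_sub, mul_one, mul_div_cancel₀ _ hA.ne']
    nlinarith
  · have hsq : (x - N * s) ^ 2 < δ ^ 2 := by nlinarith
    have hδ2 : δ ^ 2 ≤ δ := by nlinarith
    nlinarith

include hθ hb0 hb1 in
/-- **The `E`-side step: re-diagonalising `⟨β₁, β₂⟩` over `E` into blocks of mixed signs.** Let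
`β₁ = u₁ + v₁θ` be totally positive and `β₂ = u₂ + v₂θ` totally negative (signs at the real
embeddings `σ`, `σ̄ = σ ∘ τ`, `s = σ(θ) > 0`). Then there are `γ = G + Hθ`, `γ' = G' + H'θ`
of mixed signs (`N(γ), N(γ') < 0`) with `T⟨β₁⟩ ⊥ T⟨β₂⟩ ≅ T⟨γ⟩ ⊥ T⟨γ'⟩`: take
`γ = β₁ X² + β₂` with `σ(X)` large, `σ̄(X)` small (`exists_rat_nat_mixed`) and
`γ' = β₁ β₂ / γ`; then `⟨β₁, β₂⟩ ≅ ⟨γ, γ'⟩` over `E` (`equivalent_weightedSumSquares_pair`),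
and transfers of `E`-isometric forms are isometric. This realises, for a given rational form,
both sign patterns `(r₀, m - r₀)`, `r₀ ∈ {2, 3}`, of Bayer-Fluckiger–van Geemen–Schütt, Thm. 11.2.
[cite: BayerFluckigerVanGeemenSchuett2025, Thm. 11.2] -/
theorem exists_mixed_pair {s : ℝ} (hs : σ θ = s) (hs0 : 0 < s) {u₁ v₁ u₂ v₂ : ℚ}
    (h1p : 0 < (u₁ : ℝ) + v₁ * s) (h1m : 0 < (u₁ : ℝ) - v₁ * s)
    (h2p : (u₂ : ℝ) + v₂ * s < 0) (h2m : (u₂ : ℝ) - v₂ * s < 0) :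
    ∃ G H G' H' : ℚ, ((G : ℝ) + H * s) * (G - H * s) < 0 ∧ ((G' : ℝ) + H' * s) * (G' - H' * s) < 0 ∧
      Equivalent
        ((transfer E ((algebraMap ℚ E u₁ + algebraMap ℚ E v₁ * θ) • (QuadraticMap.sq (R := E)))).prod
          (transfer E ((algebraMap ℚ E u₂ + algebraMap ℚ E v₂ * θ) • (QuadraticMap.sq (R := E)))))
        ((transfer E ((algebraMap ℚ E G + algebraMap ℚ E H * θ) • (QuadraticMap.sq (R := E)))).prod
          (transfer E ((algebraMap ℚ E G' + algebraMap ℚ E H' * θ) •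
            (QuadraticMap.sq (R := E))))) := by
  obtain ⟨τ, hτ⟩ := exists_conjRingHom hθ b hb0 hb1
  have hσ : ∀ u v : ℚ, σ (algebraMap ℚ E u + algebraMap ℚ E v * θ) = u + v * s := fun u v => by
    rw [embedding_coord, hs]
  have hστ : ∀ u v : ℚ, σ (τ (algebraMap ℚ E u + algebraMap ℚ E v * θ)) = u - v * s :=
    fun u v => by rw [hτ, hσ]; push_cast; ring
  obtain ⟨x, N, hpos, hneg⟩ := exists_rat_nat_mixed h1p h1m h2p h2m hs0
  -- the elements
  set β₁ : E := algebraMap ℚ E u₁ + algebraMap ℚ E v₁ * θ with hβ₁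
  set β₂ : E := algebraMap ℚ E u₂ + algebraMap ℚ E v₂ * θ with hβ₂
  set X : E := algebraMap ℚ E x + algebraMap ℚ E N * θ with hX
  set γ : E := β₁ * X ^ 2 + β₂ with hγ
  have hσX : σ X = x + N * s := by rw [hX, hσ]; push_cast; ring
  have hστX : σ (τ X) = x - N * s := by rw [hX, hστ]; push_cast; ring
  have hσγ : σ γ = ((u₁ : ℝ) + v₁ * s) * (x + N * s) ^ 2 + (u₂ + v₂ * s) := by
    rw [hγ, map_add, map_mul, map_pow, hσX, hβ₁, hβ₂, hσ, hσ]
  have hστγ : σ (τ γ) = ((u₁ : ℝ) - v₁ * s) * (x - N * s) ^ 2 + (u₂ - v₂ * s) := by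
    rw [hγ, map_add, map_mul, map_pow, map_add, map_mul, map_pow, hστX, hβ₁, hβ₂, hστ, hστ]
  have hσγpos : 0 < σ γ := by rw [hσγ]; exact hpos
  have hστγneg : σ (τ γ) < 0 := by rw [hστγ]; exact hneg
  have hγ0 : γ ≠ 0 := fun h0 => hσγpos.ne' (by rw [h0, map_zero])
  -- `⟨β₁, β₂⟩ ≅ ⟨γ, β₁β₂/γ⟩` over `E`, then transfer
  have hpair := equivalent_weightedSumSquares_pair β₁ β₂ X 1
    (by rw [one_pow, mul_one]; exact hγ0)
  rw [one_pow, mul_one, ← hγ] at hpair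
  have htr := (Equivalent.transfer E hpair).symm
  rw [transfer_weightedSumSquares_eq_pi, transfer_weightedSumSquares_eq_pi] at htr
  -- coordinates of `γ`, `γ'`
  set γ' : E := β₁ * β₂ / γ with hγ'
  obtain ⟨G, H, hGH⟩ : ∃ G H : ℚ, γ = algebraMap ℚ E G + algebraMap ℚ E H * θ :=
    ⟨_, _, eq_coord_add_coord_mul b hb0 hb1 γ⟩
  obtain ⟨G', H', hGH'⟩ : ∃ G' H' : ℚ, γ' = algebraMap ℚ E G' + algebraMap ℚ E H' * θ :=
    ⟨_, _, eq_coord_add_coord_mul b hb0 hb1 γ'⟩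
  refine ⟨G, H, G', H', ?_, ?_, ?_⟩
  · have e1 : (G : ℝ) + H * s = σ γ := by rw [hGH, hσ]
    have e2 : (G : ℝ) - H * s = σ (τ γ) := by rw [hGH, hστ]
    rw [e1, e2]
    exact mul_neg_of_pos_of_neg hσγpos hστγneg
  · have e1 : (G' : ℝ) + H' * s = σ γ' := by rw [hGH', hσ]
    have e2 : (G' : ℝ) - H' * s = σ (τ γ') := by rw [hGH', hστ]
    rw [e1, e2, hγ', map_div₀, map_mul, map_div₀, map_mul, map_div₀, map_mul, hβ₁, hβ₂, hσ, hσ,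
      hστ, hστ]
    have hq1 : ((u₁ : ℝ) + v₁ * s) * (u₂ + v₂ * s) / σ γ < 0 :=
      div_neg_of_neg_of_pos (mul_neg_of_pos_of_neg h1p h2p) hσγpos
    have hq2 : 0 < ((u₁ : ℝ) - v₁ * s) * (u₂ - v₂ * s) / σ (τ γ) :=
      div_pos_of_neg_of_neg (mul_neg_of_pos_of_neg h1m h2m) hστγneg
    exact mul_neg_of_neg_of_pos hq1 hq2
  · refine (QuadraticMap.Equivalent.trans ?_ htr).trans ?_
    · refine QuadraticMap.Equivalent.trans ?_ (equivalent_pi_fin_two _).symm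
      exact QuadraticMap.Equivalent.refl _
    · refine (equivalent_pi_fin_two _).trans ?_
      rw [← hGH, ← hGH']
      exact QuadraticMap.Equivalent.refl _

end Signs

end Literature.NumberTheory.QuadraticForms
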